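import Summits.Langlands.Langlands.Theses.RamifiedCoefficientSeed
import Literature.NumberTheory.GaloisRepresentations.AbsIrreducibleIndexTwo
import Literature.NumberTheory.Automorphic.BCDTModularity
import Literature.FieldTheory.AlgClosed.PadicAlgClEquivComplex
import Literature.NumberTheory.Automorphic.GLnAdelicStructureProofs

/-!
# `RamifiedCoefficientSeed.SectorComplement` (stmt-Langlands-16781) — negative-side position lemmas

Disprover's kernel-checked bookkeeping (cdisprove cycle 1, 2026-08-17) for the route's declared frame
`SectorComplement := NonPolarisableFamilyAutomorphic → Langlands` (route RamifiedCoefficientSeed, crux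
rank 5, "OUT-OF-SCOPE REMAINDER = the rest of the summit … trivially implied by Langlands; filed only so
that `closes` honestly concludes the summit constant … never staffed from this route").  Write
`X := NonPolarisableFamilyAutomorphic` (the route TARGET: an infinite pairwise twist-inequivalent family of
NON-essentially-self-dual rank-3 `p`-adic representations of `Γ_ℚ`, `p ≥ 11`, every member cuspidal
automorphic with Satake–Frobenius matching a.e.), `C` the item, `S := _root_.Langlands`.  Nothing here
asserts the item, the target, a crux or the summit; every conclusion is a negation or a conditional
equivalence:

* (landed meanwhile by the line lead in `Theorems/RamifiedCoefficientSeedSectorComplementJunctionOfR.lean`,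
  namespace `…Theorems.RamifiedCoefficientSeedJunctionOfR`, and NOT restated here: `not_sectorComplement_iff`
  — `¬ C ↔ X ∧ ¬ S`, i.e. a refutation of the frame is EXACTLY a proof of the target, which is EXISTENTIAL
  over `CuspidalAutomorphicRepData 3 ℚ hcpt`, a type the tree cannot yet inhabit (no cusp form on `GL₃`, no
  automorphic induction), together with a refutation of the audited formal summit, so the frame is
  un-refutable in the current tree even if the summit were junk-false; `sectorComplement_iff_langlands_of_target`
  / `…_of_cruxes` — under the target, resp. the three ranked cruxes, `C ↔ S`; `sectorComplement_iff_not_or`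
  — the truth table `C ↔ ¬ X ∨ S`;)
* `ramifiedCoefficientSeed_not_langlands_of_family_of_not_target`: `F_geo → ¬ X → ¬ S`, where `F_geo` is
  the GALOIS-SIDE existence content of the target, spelled out inline (a pairwise twist-inequivalent family
  of non-essentially-self-dual, irreducible, a.e. unramified rank-3 representations, de Rham above `p` for
  Fontaine's pinned datum — the summit's own (B)-hypotheses member-wise; nothing automorphic, nothing
  residual, no weights): given such a family, a failure of the target is a counterexample to
  Fontaine–Mazur–Langlands (direction (B) at `n = 3`, `F = ℚ`, `𝓡` from the summit's non-vacuity conjunct,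
  `𝓡.pst = fontainePstAdicCompletion` by definition, the a.e. Satake clause is `Corresponds.1` verbatim)
  — it refutes `S` and PROVES the frame ex falso; it never refutes the frame;
* `ramifiedCoefficientSeed_not_langlands_of_explicitFamily_of_not_target`: the same from the route's own
  witness crux `ExplicitRamifiedFamily` (crystalline ⇒ de Rham; residually absolutely irreducible over
  `ℚ(ζ_p)` ⇒ irreducible; its residual-duality and conjugation clauses — the lever's inputs — unused);
* `ramifiedCoefficientSeed_not_langlands_of_not_adjointLiftingGL3`: `¬ AdjointLiftingGL3 → ¬ S` — the
  ENGINE crux is inside the summit as typed (its odd adjoint seed, labelled weights `{0,1,2}` and `11 ≤ p`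
  unused), so the route header's kill criterion "a refutation of AdjointLiftingGL3 AS TYPED would exhibit
  a geometric `ρ` contradicting Fontaine–Mazur" is exact: it would refute the formal summit; and then the
  frame is precisely `¬ X` (`ramifiedCoefficientSeed_sectorComplement_iff_not_target_of_not_adjointLiftingGL3`);
* `ramifiedCoefficientSeed_not_target_of_isEmpty_cuspidal`: the one junk model bearing on the frame — were
  the audited cuspidal interface EMPTY in rank 3 over `ℚ`, the target would be FALSE (`hcpt` holds by
  `isCompact_glFiniteIntegralLevel_holds`, `ι` exists by `PadicAlgCl.nonempty_ringEquiv_complex`), i.e.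
  the fail-safe direction of the Statement is the TRIVIALISING direction of this frame (it would become
  provable ex falso), the opposite of a refutation;
* `ramifiedCoefficientSeed_langlands_iff_engine_and_frame`: given the witness family and the lever only,
  `S ↔ AdjointLiftingGL3 ∧ C` — the summit splits exactly as engine ∧ frame (`←` is the route's
  sorry-free `closes`).

Work file with the full analysis: `Cruxes/SectorComplement/Disproof.lean`, PART III (§R1–§R8).
-/

set_option linter.dupNamespace false -- project-wide option; `Summit.Langlands.Langlands` is the mandated namespace

namespace Summit.Langlands.Langlands.Theorems

open Summit.Langlands.Langlands.Theses.RamifiedCoefficientSeed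
open Literature.NumberTheory.GaloisRepresentations Literature.NumberTheory.Automorphic

/-- Direction (B) of the summit at `n = 3`, `F = ℚ`, weak (a.e.-Satake) form, stated NEGATIVELY: if some
irreducible `ρ : Γ_ℚ → GL₃(ℚ̄_p)`, unramified a.e. and de Rham above `p` for Fontaine's pinned datum, has
no L-algebraic cuspidal `π` with Satake–Frobenius matching a.e. (for some `ι`, `hcpt`), the formal summit
is false (`𝓡` from the `Nonempty` conjunct; `𝓡.pst p v hv` is `fontainePstAdicCompletion v p hv` by
definition; `Corresponds.1` is the a.e. Satake clause). [folklore] -/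
theorem ramifiedCoefficientSeed_not_langlands_of_not_weakB_rank3 (p : ℕ) [Fact p.Prime]
    (ρ : FramedGaloisRep ℚ (PadicAlgCl p) 3) (hirr : ρ.toGaloisRep.IsIrreducible)
    (hunr : ∀ᶠ v : IsDedekindDomain.HeightOneSpectrum (NumberField.RingOfIntegers ℚ) in Filter.cofinite,
      ρ.IsUnramifiedAt v)
    (hdR : ∀ (v : IsDedekindDomain.HeightOneSpectrum (NumberField.RingOfIntegers ℚ))
      (hv : ((p : ℕ) : NumberField.RingOfIntegers ℚ) ∈ v.asIdeal),
      (Literature.NumberTheory.PAdicHodge.fontainePstAdicCompletion v p hv).IsDeRhamFramed (ρ.toLocal v))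
    (ι : PadicAlgCl p ≃+* ℂ) (hcpt : isCompact_glFiniteIntegralLevel 3 ℚ)
    (hno : ¬ ∃ π : CuspidalAutomorphicRepData 3 ℚ hcpt, π.1.IsLAlgebraic ∧
      ∀ᶠ v : IsDedekindDomain.HeightOneSpectrum (NumberField.RingOfIntegers ℚ) in Filter.cofinite,
        Summit.Langlands.SatakeFrobCompatibleAt ι π.1 ρ v) :
    ¬ _root_.Langlands := by
  intro hL
  obtain ⟨⟨𝓡⟩, hGL⟩ := hL ℚ
  obtain ⟨π, hLalg, hcorr⟩ := (hGL 𝓡 3 (by norm_num) hcpt).2 p ι ρ hirr ⟨hunr, fun v hv ↦ hdR v hv⟩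
  exact hno ⟨π, hLalg, hcorr.1⟩

/-- Residual absolute irreducibility over `ℚ(ζ_p)` (clause (E) of `ExplicitRamifiedFamily`) implies
irreducibility over `ℚ` (the summit's (B)-hypothesis): accepted
`IsResiduallyAbsIrreducible.isAbsolutelyIrreducible`, `IsAbsolutelyIrreducible.of_restrictField`,
`FramedRep.isIrreducible_toContinuousRep_iff`. [folklore] -/
theorem ramifiedCoefficientSeed_isIrreducible_of_isResiduallyAbsIrreducible {p : ℕ} [Fact p.Prime]
    (ρ : FramedGaloisRep ℚ (PadicAlgCl p) 3)
    (hirr : (ρ.restrictField (CyclotomicField p ℚ)).IsResiduallyAbsIrreducible) :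
    ρ.toGaloisRep.IsIrreducible :=
  (FramedRep.isIrreducible_toContinuousRep_iff ρ).2
    (FramedGaloisRep.IsAbsolutelyIrreducible.of_restrictField (CyclotomicField p ℚ) ρ
      (FramedGaloisRep.IsResiduallyAbsIrreducible.isAbsolutelyIrreducible three_pos hirr)).isIrreducible

/-- **Given the Galois-side family, a failure of the target refutes the summit** (and proves the frame
ex falso — it never refutes the frame).  The hypothesis `hF` is the Galois-side existence content of the
target spelled out: `p ≥ 11`, a pairwise twist-inequivalent family `f` of non-essentially-self-dual,
IRREDUCIBLE, a.e. unramified rank-3 representations, de Rham above `p` for Fontaine's pinned datum —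
exactly the summit's (B)-hypotheses member-wise; modulo `S` this is all that separates the ∃-target from
a consequence of the summit. [folklore] -/
theorem ramifiedCoefficientSeed_not_langlands_of_family_of_not_target
    (hF : ∃ (p : ℕ) (_ : Fact p.Prime), 11 ≤ p ∧ ∃ f : ℕ → FramedGaloisRep ℚ (PadicAlgCl p) 3,
      (∀ m n, m ≠ n → ¬ ∃ χ : FramedGaloisRep ℚ (PadicAlgCl p) 1, ∀ σ,
          (f m σ).val.trace = (χ σ).val 0 0 * (f n σ).val.trace) ∧
      ∀ n, (¬ ∃ χ : FramedGaloisRep ℚ (PadicAlgCl p) 1, ∀ σ,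
          (f n σ⁻¹).val.trace = (χ σ).val 0 0 * (f n σ).val.trace) ∧
        (f n).toGaloisRep.IsIrreducible ∧
        (∀ᶠ v : IsDedekindDomain.HeightOneSpectrum (NumberField.RingOfIntegers ℚ) in Filter.cofinite,
          (f n).IsUnramifiedAt v) ∧
        ∀ (v : IsDedekindDomain.HeightOneSpectrum (NumberField.RingOfIntegers ℚ))
          (hv : ((p : ℕ) : NumberField.RingOfIntegers ℚ) ∈ v.asIdeal),
          (Literature.NumberTheory.PAdicHodge.fontainePstAdicCompletion v p hv).IsDeRhamFramed
            ((f n).toLocal v))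
    (hX : ¬ NonPolarisableFamilyAutomorphic) : ¬ _root_.Langlands := by
  intro hL
  obtain ⟨p, hp, h11, f, hne, hf⟩ := hF
  apply hX
  refine ⟨p, hp, h11, f, hne, fun n ↦ (hf n).1, fun n ι hcpt ↦ ?_⟩
  obtain ⟨_hnsd, hirr, hunr, hdR⟩ := hf n
  by_contra hno
  exact ramifiedCoefficientSeed_not_langlands_of_not_weakB_rank3 p (f n) hirr hunr hdR ι hcpt hno hL

/-- **… in particular from the route's own witness crux**: `ExplicitRamifiedFamily → ¬ X → ¬ S`
(crystalline ⇒ de Rham, `IsCrystallineFramed.isDeRhamFramed`; residual absolute irreducibility ⇒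
irreducibility; the residual-duality clause (D) and the conjugation-trace clause (F) of the crux — the
inputs of the lever `AdjointSeedFromDuality` — are NOT used). [folklore] -/
theorem ramifiedCoefficientSeed_not_langlands_of_explicitFamily_of_not_target
    (h1 : ExplicitRamifiedFamily) (hX : ¬ NonPolarisableFamilyAutomorphic) : ¬ _root_.Langlands := by
  refine ramifiedCoefficientSeed_not_langlands_of_family_of_not_target ?_ hX
  obtain ⟨p, hp, h11, f, hne, hf⟩ := h1
  refine ⟨p, hp, h11, f, hne, fun n ↦ ?_⟩
  obtain ⟨hnsd, hunr, hcrys, _hdual, hirr, _hcc⟩ := hf n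
  exact ⟨hnsd, ramifiedCoefficientSeed_isIrreducible_of_isResiduallyAbsIrreducible (f n) hirr, hunr,
    fun v hv ↦ (hcrys v hv).1.isDeRhamFramed⟩

/-- **The engine crux is inside the summit**: `¬ AdjointLiftingGL3 → ¬ Langlands` (direction (B) at
`n = 3`, `F = ℚ`; the odd adjoint seed, the labelled weights `{0,1,2}` and `11 ≤ p` are unused;
crystalline ⇒ de Rham).  The route header's kill criterion, kernel-checked: a refutation of the engine AS
TYPED is a counterexample to Fontaine–Mazur and refutes the formal summit. [folklore] -/
theorem ramifiedCoefficientSeed_not_langlands_of_not_adjointLiftingGL3 (h : ¬ AdjointLiftingGL3) :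
    ¬ _root_.Langlands := by
  intro hL
  apply h
  intro p _ _h11 ρ hunr hcrys hirr _hseed ι hcpt
  by_contra hno
  exact ramifiedCoefficientSeed_not_langlands_of_not_weakB_rank3 p ρ
    (ramifiedCoefficientSeed_isIrreducible_of_isResiduallyAbsIrreducible ρ hirr) hunr
    (fun v hv ↦ (hcrys v hv).1.isDeRhamFramed) ι hcpt hno hL

/-- … and in the world where the engine fails, the frame is EXACTLY the negation of the target:
`¬ AdjointLiftingGL3 → (SectorComplement ↔ ¬ NonPolarisableFamilyAutomorphic)`. [folklore] -/
theorem ramifiedCoefficientSeed_sectorComplement_iff_not_target_of_not_adjointLiftingGL3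
    (h : ¬ AdjointLiftingGL3) : SectorComplement ↔ ¬ NonPolarisableFamilyAutomorphic :=
  ⟨fun hC hX ↦ ramifiedCoefficientSeed_not_langlands_of_not_adjointLiftingGL3 h (hC hX),
    fun hX h' ↦ (hX h').elim⟩

/-- **The one junk model bearing on the frame**: were the audited cuspidal interface EMPTY in rank 3
over `ℚ` (an unsatisfiable-as-typed `AutomorphicRepData`), the target would be false — `hcpt` holds
(`isCompact_glFiniteIntegralLevel_holds`) and `ι` exists (`PadicAlgCl.nonempty_ringEquiv_complex`), so
the member `f 0` would need a `π` that does not exist — and the frame provable ex falso: the fail-safe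
direction of the Statement is the trivialising direction of this frame, never a refutation.
Hypothetical; recorded to close the door. [folklore] -/
theorem ramifiedCoefficientSeed_not_target_of_isEmpty_cuspidal
    (h : ∀ hcpt : isCompact_glFiniteIntegralLevel 3 ℚ, IsEmpty (CuspidalAutomorphicRepData 3 ℚ hcpt)) :
    ¬ NonPolarisableFamilyAutomorphic := by
  rintro ⟨p, hp, _h11, f, _hne, _hnsd, haut⟩
  obtain ⟨ι⟩ := PadicAlgCl.nonempty_ringEquiv_complex p
  obtain ⟨π, -⟩ := haut 0 ι (isCompact_glFiniteIntegralLevel_holds 3 ℚ)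
  exact (h _).false π

/-- Given the witness family (r2) and the lever (r4) only, the summit splits EXACTLY as engine ∧ frame:
`Langlands ↔ AdjointLiftingGL3 ∧ SectorComplement` (`→`: the engine is summit-implied and the frame
discards its hypothesis; `←`: `closes`). [folklore] -/
theorem ramifiedCoefficientSeed_langlands_iff_engine_and_frame (h1 : ExplicitRamifiedFamily)
    (h2 : AdjointSeedFromDuality) : _root_.Langlands ↔ AdjointLiftingGL3 ∧ SectorComplement :=
  ⟨fun hL ↦ ⟨by_contra fun h ↦ ramifiedCoefficientSeed_not_langlands_of_not_adjointLiftingGL3 h hL,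
      fun _ ↦ hL⟩,
    fun h ↦ closes h1 h2 h.1 h.2⟩

end Summit.Langlands.Langlands.Theorems
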